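import Summits.SmoothPoincare4.SmoothPoincare4.Theorems.CylinderEntropySliceIsolationStubSeparationPersistsAux5
import HarnessLib

/-!
# End-separation persists along a cylinder flow, part 6: families — the uniform push-off lemma

Part of the proof of the stub `stub_separationPersists` (END-SEPARATION PERSISTS ALONG A CYLINDER
FLOW) of line `conformal-kernel-domination` (closing chain γ) of the crux `CylinderEntropy.SliceIsolation`
(stmt-SmoothPoincare4-7632); see `CylinderEntropySliceIsolationStubSeparationPersists.lean` for the
overall argument. Everything here is proved (no named facts).

* `cylFlow_inner_eq_zero_of_pushoff_seq` — the family version of the sequential push-off lemma of the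
  flux identity (`inner_eq_zero_of_pushoff_seq`): chords of the slice `F sₙ` through pushed-off
  points are controlled by the STRICT derivative of the joint chart representative at `(t, φ x₀)`;
* `cylFlow_exists_uniform_pushoff` — **uniform push-off radius**: for `t ≥ T` there are `τ₀, θ > 0`
  such that for all times `s ≥ T` with `|s - t| < θ` the normalised push-offs
  `nrm(F(s,x) ± τ ν(s,x))`, `0 < τ ≤ τ₀`, miss the slice `F s (M)` (compactness of `M` and of the
  unit sphere, limits of unit normals are unit normals).

## References

* M. W. Hirsch, *Differential Topology*, GTM 33 (1976), Ch. 4 §5 (tubular neighbourhoods), Ch. 8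
  Thm. 1.3 (isotopy extension). [HirschDT1976]
* A. Hatcher, *Algebraic Topology*, CUP (2002), Prop. 3.46 (Jordan–Brouwer separation via Alexander
  duality). [HatcherAT2002]
-/

set_option linter.dupNamespace false

noncomputable section

open MeasureTheory Set Function Filter Module Asymptotics Metric
open scoped Manifold ContDiff ENNReal Topology RealInnerProductSpace NNReal

namespace Summit.SmoothPoincare4.SmoothPoincare4.Theorems.CylinderEntropySliceIsolation

open Summit.SmoothPoincare4.SmoothPoincare4.Theorems.CylinderRungTwo.KillingFlux
open Literature.Geometry.Riemannian
open Literature.Geometry.Lorentzian Literature.Geometry.Lorentzian.PseudoRiemannianMetric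
open Literature.Geometry.Riemannian.SphericalCylinderEntropy (truncL truncL_apply lipschitz_truncL)
open Literature.Geometry.Manifold.CylinderSlice (axis castSucc_ne_five padL padL_apply_castSucc
  padL_apply_last)

/-- `‖z'‖ = 1` on `N` (private copy of the tree's
`CylinderEntropySliceIsolationConformalMapLipschitz.norm_truncL_eq_one`, renamed and kept local to avoid importing
all of Mathlib through that module). [folklore] -/
private theorem norm_truncL_eq_one_of_mem_cyl {z : EuclideanSpace ℝ (Fin 6)} (hz : ∑ i : Fin 5, z (Fin.castSucc i) ^ 2 = 1) :
    ‖truncL z‖ = 1 := by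
  rw [← Real.sqrt_sq (norm_nonneg _), norm_truncL_sq, hz, Real.sqrt_one]

section FamilyPushoff

open Summit.SmoothPoincare4.SmoothPoincare4.Cruxes.CylinderRungTwo.KillingFlux (IsCylinderMCF)

variable {M : Type} [TopologicalSpace M] [ChartedSpace (EuclideanSpace ℝ (Fin 4)) M]
  [IsManifold (𝓡 4) ∞ M]

variable {F : ℝ → M → EuclideanSpace ℝ (Fin 6)} {ν : ℝ → M → EuclideanSpace ℝ (Fin 6)} {T : ℝ}

/-- A sign-fixed unit vector close to a reference unit vector: if `‖w‖ = ‖w₀‖ = 1` and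
`1 - c²/2 < ⟪w, w₀⟫` then `‖w - w₀‖ < c`. [folklore] -/
theorem norm_sub_lt_of_inner_gt {w w₀ : EuclideanSpace ℝ (Fin 6)} (hw : ‖w‖ = 1) (hw₀ : ‖w₀‖ = 1) {c : ℝ}
    (hc : 0 < c) (h : 1 - c ^ 2 / 2 < ⟪w, w₀⟫) : ‖w - w₀‖ < c := by
  have hsq : ‖w - w₀‖ ^ 2 < c ^ 2 := by
    rw [norm_sub_sq_real, hw, hw₀]; linarith
  exact (pow_lt_pow_iff_left₀ (norm_nonneg _) hc.le two_ne_zero).1 hsq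

/-- **Sequential push-off lemma for families** (the family version of
`inner_eq_zero_of_pushoff_seq`). Along a cylinder flow let `sₙ → t` (`sₙ, t ≥ T`), `xₙ → x₀`,
directions `κₙ → κ₀` tangent to `N` at `F(sₙ, xₙ)`, and `τₙ → 0⁺`. If every normalised push-off
`nrm(F(sₙ, xₙ) + τₙ κₙ)` lies on the slice `F sₙ (M)`, then `⟪κ₀, ν(t, x₀)⟫ = 0`: the hit points
`F(sₙ, yₙ)` converge to `F(t, x₀)`, so `yₙ → x₀` (uniform convergence of the slices + `F t` an
embedding); in the chart at `x₀` the chords `F(sₙ, yₙ) - F(sₙ, xₙ) = τₙ κₙ + O(τₙ²)` are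
`A(φ yₙ - φ xₙ) + o(‖φ yₙ - φ xₙ‖)` by STRICT differentiability of the JOINT chart representative
`(s, a) ↦ F s (φ⁻¹ a)` at `(t, φ x₀)` (same time `sₙ` in both terms), `A = D(F t ∘ φ⁻¹)(φ x₀)` is
injective with normal `ν(t, x₀)`, whence `⟪κₙ, ν(t, x₀)⟫ → 0`. [folklore] -/
-- adapted from `inner_eq_zero_of_pushoff_seq`
-- (Theorems/CylinderEntropyCylinderRungTwoFluxIdentityPushOff.lean)
theorem cylFlow_inner_eq_zero_of_pushoff_seq [T2Space M] [CompactSpace M] (h : IsCylinderMCF M F ν T)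
    {t : ℝ} (ht : T ≤ t) {s : ℕ → ℝ} (hsT : ∀ n, T ≤ s n) (hst : Tendsto s atTop (𝓝 t))
    {x : ℕ → M} {x₀ : M} (hx : Tendsto x atTop (𝓝 x₀))
    {κ : ℕ → EuclideanSpace ℝ (Fin 6)} {κ₀ : EuclideanSpace ℝ (Fin 6)} (hκ : Tendsto κ atTop (𝓝 κ₀))
    (hκt : ∀ n, ∑ i : Fin 5, κ n (Fin.castSucc i) * F (s n) (x n) (Fin.castSucc i) = 0)
    {τ : ℕ → ℝ} (hτ : Tendsto τ atTop (𝓝 0)) (hτ0 : ∀ n, 0 < τ n)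
    {y : ℕ → M} (hy : ∀ n, (fun z : EuclideanSpace ℝ (Fin 6) => (‖truncL z‖⁻¹ : ℝ) • (z - z (5 : Fin 6) • (axis :
          EuclideanSpace ℝ (Fin 6))) + z (5 : Fin 6) • (axis : EuclideanSpace ℝ (Fin 6))) (F (s n) (x n) + τ n • κ n) =
          F (s n) (y n)) :
    ⟪κ₀, ν t x₀⟫ = 0 := by
  obtain ⟨U, hU, hTU, hF⟩ := h.contMDiffOn
  have htU : t ∈ U := hTU (mem_Ici.2 ht)
  have hι : Manifold.IsSmoothEmbedding (𝓡 4) (𝓡 6) ∞ (F t) := h.isSmoothEmbedding t ht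
  have hιN : ∀ z, ∑ i : Fin 5, F t z (Fin.castSucc i) ^ 2 = 1 := h.mem_cyl t ht
  have hνn := h.isUnitNormal t ht
  -- the pushed-off points converge to `F t x₀`, hence so do the hit points
  have hFlim : Tendsto (fun n => F (s n) (x n)) atTop (𝓝 (F t x₀)) :=
    (continuousAt_family hU hF htU x₀).tendsto.comp (hst.prodMk_nhds hx)
  have hz : Tendsto (fun n => F (s n) (x n) + τ n • κ n) atTop (𝓝 (F t x₀)) := by
    have := hFlim.add (hτ.smul hκ)
    simpa using this
  have hnrm_at : ContinuousAt (fun z : EuclideanSpace ℝ (Fin 6) => (‖truncL z‖⁻¹ : ℝ) • (z - z (5 : Fin 6) • (axis :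
        EuclideanSpace ℝ (Fin 6))) + z (5 : Fin 6) • (axis : EuclideanSpace ℝ (Fin 6))) (F t x₀) := by
    refine continuousOn_nrm.continuousAt ((isOpen_ne_fun truncL.continuous continuous_const).mem_nhds ?_)
    show truncL (F t x₀) ≠ 0
    rw [← norm_ne_zero_iff, norm_truncL_eq_one_of_mem_cyl (hιN x₀)]
    exact one_ne_zero
  have hyι : Tendsto (fun n => F (s n) (y n)) atTop (𝓝 (F t x₀)) := by
    have h1 := hnrm_at.tendsto.comp hz
    have h0 := nrm_eq_self (hιN x₀)
    beta_reduce at h0 h1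
    rw [h0] at h1
    refine h1.congr fun n => ?_
    have := hy n
    beta_reduce at this
    exact this
  -- uniform closeness of the slices: `F t (yₙ) → F t x₀`, so `yₙ → x₀`
  have hFy : Tendsto (fun n => F t (y n)) atTop (𝓝 (F t x₀)) := by
    rw [Metric.tendsto_nhds]
    intro ε hε
    have h1 : ∀ᶠ n in atTop, dist (F (s n) (y n)) (F t x₀) < ε / 2 := Metric.tendsto_nhds.1 hyι _ (half_pos hε)
    obtain ⟨θ, hθ, hclose⟩ := cylFlow_uniform_close h ht (half_pos hε)
    have h2 : ∀ᶠ n in atTop, |s n - t| < θ := by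
      have := Metric.tendsto_nhds.1 hst θ hθ
      simpa only [Real.dist_eq] using this
    filter_upwards [h1, h2] with n hn1 hn2
    have hn2' : dist (F t (y n)) (F (s n) (y n)) < ε / 2 := by
      rw [dist_comm, dist_eq_norm]; exact hclose (s n) (hsT n) hn2 (y n)
    calc dist (F t (y n)) (F t x₀) ≤ dist (F t (y n)) (F (s n) (y n)) + dist (F (s n) (y n)) (F t x₀) :=
          dist_triangle _ _ _
      _ < ε / 2 + ε / 2 := add_lt_add hn2' hn1
      _ = ε := by ring
  have hyx : Tendsto y atTop (𝓝 x₀) := hι.isEmbedding.tendsto_nhds_iff.2 hFy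
  -- the chart at `x₀`
  set φ := extChartAt (𝓡 4) x₀ with hφ
  set a₀ : EuclideanSpace ℝ (Fin 4) := φ x₀ with ha₀
  have hx₀s : x₀ ∈ φ.source := mem_extChartAt_source x₀
  have ha₀t : a₀ ∈ φ.target := φ.map_source hx₀s
  have hsymm : φ.symm a₀ = x₀ := φ.left_inv hx₀s
  have ha : Tendsto (fun n => φ (x n)) atTop (𝓝 a₀) := (continuousAt_extChartAt x₀).tendsto.comp hx
  have hb : Tendsto (fun n => φ (y n)) atTop (𝓝 a₀) := (continuousAt_extChartAt x₀).tendsto.comp hyx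
  -- strict differentiability of the JOINT chart representative at `(t, a₀)`; space partial `A ⊥ ν(t, x₀)`
  set 𝒢 : ℝ × EuclideanSpace ℝ (Fin 4) → EuclideanSpace ℝ (Fin 6) := fun q => F q.1 (φ.symm q.2) with h𝒢
  have hstrict : HasStrictFDerivAt 𝒢 (fderiv ℝ 𝒢 (t, a₀)) (t, a₀) :=
    (contDiffAt_jointChartRep hU hF x₀ (q := (t, a₀)) htU ha₀t).hasStrictFDerivAt (by simp)
  set A : EuclideanSpace ℝ (Fin 4) →L[ℝ] EuclideanSpace ℝ (Fin 6) := ((ContinuousLinearMap.comp (mfderiv (𝓡 4)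
        (𝓡 6) (F t) ((extChartAt (𝓡 4) x₀).symm a₀)) (mfderivWithin 𝓘(ℝ, EuclideanSpace ℝ (Fin 4)) (𝓡 4) (extChartAt (𝓡
        4) x₀).symm (Set.range (𝓡 4)) a₀)) : EuclideanSpace ℝ (Fin 4) →L[ℝ] EuclideanSpace ℝ (Fin 6)) with hA
  have hAeq : (fderiv ℝ 𝒢 (t, a₀)).comp (ContinuousLinearMap.inr ℝ ℝ (EuclideanSpace ℝ (Fin 4))) = A :=
    fderiv_jointChartRep_comp_inr hU hF x₀ htU ha₀t
  have hAinj : Injective A := chartDeriv_injective hι x₀ ha₀t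
  obtain ⟨K, hK0, hK⟩ := (A : EuclideanSpace ℝ (Fin 4) →ₗ[ℝ] EuclideanSpace ℝ (Fin
        6)).exists_antilipschitzWith (LinearMap.ker_eq_bot.2 hAinj)
  have hKd : ∀ d : EuclideanSpace ℝ (Fin 4), ‖d‖ ≤ K * ‖A d‖ := fun d => hK.le_mul_norm (map_zero _) d
  have hAν : ∀ d : EuclideanSpace ℝ (Fin 4), ⟪A d, ν t x₀⟫ = 0 := by
    intro d
    have h := inner_nu_mfderiv hνn (φ.symm a₀)
      ((mfderivWithin 𝓘(ℝ, EuclideanSpace ℝ (Fin 4)) (𝓡 4) φ.symm (range (𝓡 4)) a₀) d)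
    have hνeq : ν t (φ.symm a₀) = ν t x₀ := by rw [hsymm]
    rw [hνeq] at h
    rw [real_inner_comm]
    exact h
  -- little-o along the pair sequence (same time `sₙ` in both points)
  have hpair : Tendsto (fun n => ((s n, φ (y n)), (s n, φ (x n)))) atTop (𝓝 ((t, a₀), (t, a₀))) :=
    (hst.prodMk_nhds hb).prodMk_nhds (hst.prodMk_nhds ha)
  have hlo := hstrict.isLittleO.comp_tendsto hpair
  -- suppose the conclusion fails
  by_contra hne
  set δ : ℝ := |⟪κ₀, ν t x₀⟫| with hδ
  have hδ0 : 0 < δ := abs_pos.2 hne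
  set C : ℝ := ‖κ₀‖ + 1 with hC
  have hC0 : 0 < C := by positivity
  have hK0' : (0 : ℝ) < K := by exact_mod_cast hK0
  set ε : ℝ := δ / (64 * K * C) with hε
  have hε0 : 0 < ε := by positivity
  -- eventual facts
  have e1 : ∀ᶠ n in atTop, x n ∈ φ.source := hx (isOpen_extChartAt_source x₀ |>.mem_nhds hx₀s)
  have e2 : ∀ᶠ n in atTop, y n ∈ φ.source := hyx (isOpen_extChartAt_source x₀ |>.mem_nhds hx₀s)
  have e3 : ∀ᶠ n in atTop, ‖κ n‖ < C := (hκ.norm).eventually (Iio_mem_nhds (lt_add_one _))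
  have e4 : ∀ᶠ n in atTop, τ n < min (1 / C) (δ / (8 * C ^ 2)) :=
    hτ.eventually (Iio_mem_nhds (lt_min (by positivity) (by positivity)))
  have e5 : ∀ᶠ n in atTop, ‖𝒢 (s n, φ (y n)) - 𝒢 (s n, φ (x n)) -
      (fderiv ℝ 𝒢 (t, a₀)) ((s n, φ (y n)) - (s n, φ (x n)))‖ ≤ ε * ‖(s n, φ (y n)) - (s n, φ (x n))‖ :=
    hlo.def hε0
  have e6 : ∀ᶠ n in atTop, dist ⟪κ n, ν t x₀⟫ ⟪κ₀, ν t x₀⟫ < δ / 4 :=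
    (hκ.inner tendsto_const_nhds).eventually (Metric.ball_mem_nhds _ (by positivity))
  obtain ⟨n, h1, h2, h3, h4, h5, h6⟩ := (e1.and (e2.and (e3.and (e4.and (e5.and e6))))).exists
  -- the chord `w`, its chart preimage `d`, and the error `e`
  have hFx : 𝒢 (s n, φ (x n)) = F (s n) (x n) := by
    show F (s n) (φ.symm (φ (x n))) = F (s n) (x n); rw [φ.left_inv h1]
  have hFy' : 𝒢 (s n, φ (y n)) = F (s n) (y n) := by
    show F (s n) (φ.symm (φ (y n))) = F (s n) (y n); rw [φ.left_inv h2]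
  have hdiff : ((s n, φ (y n)) : ℝ × EuclideanSpace ℝ (Fin 4)) - (s n, φ (x n)) = ((0 : ℝ), φ (y n) - φ (x n)) := by
    rw [Prod.mk_sub_mk, sub_self]
  have hnorm : ‖(((0 : ℝ), φ (y n) - φ (x n)) : ℝ × EuclideanSpace ℝ (Fin 4))‖ = ‖φ (y n) - φ (x n)‖ := by
    simp [Prod.norm_def]
  have hLA : (fderiv ℝ 𝒢 (t, a₀)) ((0 : ℝ), φ (y n) - φ (x n)) = A (φ (y n) - φ (x n)) := by
    rw [← hAeq, ContinuousLinearMap.comp_apply, ContinuousLinearMap.inr_apply]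
  rw [hFx, hFy', hdiff, hnorm, hLA] at h5
  set w : EuclideanSpace ℝ (Fin 6) := F (s n) (y n) - F (s n) (x n) with hw
  set d : EuclideanSpace ℝ (Fin 4) := φ (y n) - φ (x n) with hd
  set e : EuclideanSpace ℝ (Fin 6) := w - A d with he
  clear_value e d w
  have hτn := hτ0 n
  have hτ1 : τ n < 1 / C := lt_of_lt_of_le h4 (min_le_left _ _)
  have hτ2 : τ n < δ / (8 * C ^ 2) := lt_of_lt_of_le h4 (min_le_right _ _)
  -- `‖w - τ κₙ‖ ≤ τ² C²`
  have hw1 : ‖w - τ n • κ n‖ ≤ τ n ^ 2 * C ^ 2 := by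
    have := (norm_nrm_sub_le (h.mem_cyl (s n) (hsT n) (x n)) (hκt n) (τ n)).2
    have hyn := hy n
    beta_reduce at this hyn
    rw [hyn] at this
    have heq : F (s n) (y n) - (F (s n) (x n) + τ n • κ n) = w - τ n • κ n := by rw [hw]; abel
    rw [heq] at this
    refine this.trans ?_
    have : ‖κ n‖ ^ 2 ≤ C ^ 2 := by
      have := h3.le; have h0 := norm_nonneg (κ n); nlinarith
    nlinarith [sq_nonneg (τ n)]
  have hτC : τ n * C ≤ 1 := by
    rw [lt_div_iff₀ hC0] at hτ1; linarith
  have hδC : δ ≤ C := by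
    rw [hδ]
    refine (abs_real_inner_le_norm _ _).trans ?_
    rw [norm_nu hνn x₀, mul_one, hC]; linarith
  -- `‖d‖ ≤ K (‖w‖ + ε ‖d‖)` and `|⟪w, ν⟫| ≤ ‖e‖ ≤ ε ‖d‖`
  have hdK : ‖d‖ ≤ K * (‖w‖ + ε * ‖d‖) := by
    have hAd : ‖A d‖ ≤ ‖w‖ + ‖e‖ := by
      have : A d = w - e := by rw [he]; abel
      rw [this]; exact norm_sub_le _ _
    calc ‖d‖ ≤ K * ‖A d‖ := hKd d
      _ ≤ K * (‖w‖ + ‖e‖) := by gcongr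
      _ ≤ K * (‖w‖ + ε * ‖d‖) := by gcongr
  have hwν : |⟪w, ν t x₀⟫| ≤ ε * ‖d‖ := by
    have : ⟪w, ν t x₀⟫ = ⟪e, ν t x₀⟫ := by
      rw [he, inner_sub_left, hAν d, sub_zero]
    rw [this]
    refine (abs_real_inner_le_norm _ _).trans ?_
    rw [norm_nu hνn x₀, mul_one]
    exact h5
  have hτ2' : τ n * C ^ 2 < δ / 8 := by
    rw [lt_div_iff₀ (by positivity)] at hτ2; linarith
  have hend := pushoff_endgame hτn hC0 hK0' hδ0 hδC hε (norm_nu hνn x₀) hw1 h3.le hτC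
    (norm_nonneg d) hdK hwν hτ2'
  -- but `|⟪κₙ, ν⟫| > 3δ/4`
  rw [Real.dist_eq] at h6
  have := abs_sub_abs_le_abs_sub ⟪κ₀, ν t x₀⟫ ⟪κ n, ν t x₀⟫
  rw [abs_sub_comm] at this
  rw [hδ] at hend h6
  linarith

/-- **Uniform push-off lemma for the flow.** For `t ≥ T` there are `τ₀ > 0` and `θ > 0` such
that for every time `s ≥ T` with `|s - t| < θ`, every `x ∈ M` and every `0 < τ ≤ τ₀`, the two
normalised push-offs `nrm(F(s, x) ± τ ν(s, x))` miss the slice `F s (M)` (compactness of `M` and of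
the unit sphere of `ℝ⁶`, the sequential lemma, and `limits of unit normals are unit normals`).
[folklore] -/
theorem cylFlow_exists_uniform_pushoff [T2Space M] [CompactSpace M] (h : IsCylinderMCF M F ν T)
    {t : ℝ} (ht : T ≤ t) :
    ∃ τ₀ : ℝ, 0 < τ₀ ∧ ∃ θ : ℝ, 0 < θ ∧ ∀ s : ℝ, T ≤ s → |s - t| < θ → ∀ x : M, ∀ τ ∈ Ioc (0 : ℝ) τ₀,
      (fun z : EuclideanSpace ℝ (Fin 6) => (‖truncL z‖⁻¹ : ℝ) • (z - z (5 : Fin 6) •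
        (axis : EuclideanSpace ℝ (Fin 6))) + z (5 : Fin 6) • (axis : EuclideanSpace ℝ (Fin 6))) (F s x + τ • ν s x) ∉
          range (F s) ∧
      (fun z : EuclideanSpace ℝ (Fin 6) => (‖truncL z‖⁻¹ : ℝ) • (z - z (5 : Fin 6) •
        (axis : EuclideanSpace ℝ (Fin 6))) + z (5 : Fin 6) • (axis : EuclideanSpace ℝ (Fin 6))) (F s x + τ • (-ν s x)) ∉
          range (F s) := by
  haveI : TopologicalSpace.MetrizableSpace M := Manifold.metrizableSpace (𝓡 4) M
  by_contra H
  push Not at H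
  -- a bad sequence with `τ₀ = θ = 1/(n+1)`
  have hbad : ∀ n : ℕ, ∃ s : ℝ, T ≤ s ∧ |s - t| < 1 / ((n : ℝ) + 1) ∧ ∃ x : M, ∃ τ : ℝ,
      τ ∈ Ioc (0 : ℝ) (1 / ((n : ℝ) + 1)) ∧ ∃ κ : EuclideanSpace ℝ (Fin 6), (κ = ν s x ∨ κ = -ν s x) ∧
      (fun z : EuclideanSpace ℝ (Fin 6) => (‖truncL z‖⁻¹ : ℝ) • (z - z (5 : Fin 6) •
        (axis : EuclideanSpace ℝ (Fin 6))) + z (5 : Fin 6) • (axis : EuclideanSpace ℝ (Fin 6))) (F s x + τ • κ) ∈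
          range (F s) := by
    intro n
    obtain ⟨s, hsT, hst, x, τ, hτ, hmem⟩ := H (1 / ((n : ℝ) + 1)) (by positivity) (1 / ((n : ℝ) + 1)) (by positivity)
    by_cases hP : (fun z : EuclideanSpace ℝ (Fin 6) => (‖truncL z‖⁻¹ : ℝ) • (z - z (5 : Fin 6) •
        (axis : EuclideanSpace ℝ (Fin 6))) + z (5 : Fin 6) • (axis : EuclideanSpace ℝ (Fin 6))) (F s x + τ • ν s x) ∈
          range (F s)
    · exact ⟨s, hsT, hst, x, τ, hτ, ν s x, Or.inl rfl, hP⟩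
    · exact ⟨s, hsT, hst, x, τ, hτ, -ν s x, Or.inr rfl, hmem hP⟩
  choose s hsT hst x τ hτI κ hκ hmem using hbad
  choose y hy using hmem
  -- subsequence with `(xₙ, κₙ) → (x₀, κ₀)`
  have hκ1 : ∀ n, κ n ∈ Metric.sphere (0 : EuclideanSpace ℝ (Fin 6)) 1 := fun n => by
    rw [mem_sphere_zero_iff_norm]
    rcases hκ n with hk | hk
    · rw [hk]; exact norm_nu (h.isUnitNormal (s n) (hsT n)) (x n)
    · rw [hk, norm_neg]; exact norm_nu (h.isUnitNormal (s n) (hsT n)) (x n)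
  have hcpt : IsCompact ((univ : Set M) ×ˢ Metric.sphere (0 : EuclideanSpace ℝ (Fin 6)) 1) :=
    isCompact_univ.prod (isCompact_sphere 0 1)
  obtain ⟨⟨x₀, κ₀⟩, -, φ, hφ, hlim⟩ := hcpt.tendsto_subseq (x := fun n => (x n, κ n)) fun n => ⟨mem_univ _, hκ1 n⟩
  have hxφ : Tendsto (fun n => x (φ n)) atTop (𝓝 x₀) := (continuous_fst.tendsto _).comp hlim
  have hκφ : Tendsto (fun n => κ (φ n)) atTop (𝓝 κ₀) := (continuous_snd.tendsto _).comp hlim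
  have h1div : Tendsto (fun n => 1 / ((φ n : ℝ) + 1)) atTop (𝓝 0) :=
    tendsto_one_div_add_atTop_nhds_zero_nat.comp hφ.tendsto_atTop
  have hsφ : Tendsto (fun n => s (φ n)) atTop (𝓝 t) := by
    rw [tendsto_iff_dist_tendsto_zero]
    refine tendsto_of_tendsto_of_tendsto_of_le_of_le tendsto_const_nhds h1div (fun n => dist_nonneg) fun n => ?_
    rw [Real.dist_eq]; exact (hst (φ n)).le
  have hτ0 : ∀ n, 0 < τ (φ n) := fun n => (hτI (φ n)).1
  have hτlim : Tendsto (fun n => τ (φ n)) atTop (𝓝 0) :=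
    tendsto_of_tendsto_of_tendsto_of_le_of_le tendsto_const_nhds h1div (fun n => (hτ0 n).le) fun n => (hτI (φ n)).2
  have hκt : ∀ n, ∑ i : Fin 5, κ (φ n) (Fin.castSucc i) * F (s (φ n)) (x (φ n)) (Fin.castSucc i) = 0 := by
    intro n
    have key := h.normal_tangent (s (φ n)) (hsT (φ n)) (x (φ n))
    rcases hκ (φ n) with hk | hk
    · rw [hk]; exact key
    · rw [hk]; simp only [PiLp.neg_apply, neg_mul, Finset.sum_neg_distrib, key, neg_zero]
  have hzero := cylFlow_inner_eq_zero_of_pushoff_seq h ht (fun n => hsT (φ n)) hsφ hxφ hκφ hκt hτlim hτ0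
    (y := fun n => y (φ n)) fun n => (hy (φ n)).symm
  have hone := cylFlow_abs_inner_eq_one_of_tendsto h ht x₀ (fun n => hsT (φ n)) hsφ hxφ (fun n => hκ (φ n)) hκφ
  rw [hzero, abs_zero] at hone
  exact zero_ne_one hone

end FamilyPushoff

/-- Marker of this part (registered sub-goal `helper_sepPersistsNormSubLt` of stmt-SmoothPoincare4-7632): a unit vector with `⟪w, w₀⟫ > 1 - c²/2` is `c`-close to the unit vector `w₀` (`norm_sub_lt_of_inner_gt`, the sign-fixing of the normal). [folklore] -/
theorem helper_sepPersistsNormSubLt :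
    ∀ (w w₀ : EuclideanSpace ℝ (Fin 6)), ‖w‖ = 1 → ‖w₀‖ = 1 → ∀ c : ℝ, 0 < c → 1 - c ^ 2 / 2 < inner ℝ w w₀ → ‖w - w₀‖ < c :=
  fun _ _ hw hw₀ _ hc h => norm_sub_lt_of_inner_gt hw hw₀ hc h

end Summit.SmoothPoincare4.SmoothPoincare4.Theorems.CylinderEntropySliceIsolation
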